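import Mathlib
import HarnessLib
import HarnessLib.Audit
import Summits.ValiantsHypothesis.ValiantsHypothesis.Theorems.SoloBlindTwoSum

/-!
# The vertex graph of the two-sum form: validity-free structure lemmas and the lower-summand conjecture

Setting of `SoloBlindTwoSum`: a finite `I ⊆ ℤ²`, `A = I ∖ {0}`, outer pair sums `W(I) = (A + A) ∖ I`
(`outerSums`), and strict vertices of `conv W(I) + cone A` (`IsStrictVertex I v`: `v ∈ W(I)` and an integer
functional, positive on `A`, uniquely minimised over `W(I)` at `v`).  Every strict vertex is an edge `{p, q}`
(or a loop `p = q`) of the *vertex graph* on `A`.  None of the lemmas below uses validity (`Separated`): they are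
facts about the boundary of `conv((A+A)∖A) + cone A` for an arbitrary finite `A`.

* `pairSum_mem_of_lt` — the workhorse: if a functional `f` witnesses the strict vertex `v`, every pair sum
  `r + s` (`r, s ∈ A`) with `f (r+s) < f v` lies in `I`.  Corollaries: the **partner lemma**
  `partner_of_lt_upper` (if `v = p + q` then `p + r ∈ I` for every `r ∈ A` with `f r < f q`), the
  **doubling lemma** `lower_double_mem` (`f p < f q ⇒ p + p ∈ I`), the **key lemma** `pairSum_mem_of_below_lower`
  (an element strictly below the lower summand is partnered with everything weakly below the upper summand), and
  `not_lowerSummand_of_double_vertex` (if `p + p` is a strict vertex, `p` is never a strict lower summand).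
* `strictVertex_no_parallelogram` — **rectangle-freeness**: strict vertices satisfy `v₁ + v₂ = v₃ + v₄` only
  trivially.  Hence the vertex graph contains no 4-cycle `p+q, p'+q, p'+q', p+q'` of strict vertices and no strict
  vertex is the midpoint of two others.  (Proof: with `d = v₃ - v₁`, `d' = v₄ - v₁` the four witnessing
  functionals have sign patterns `(+,+), (≤0,≤0), (-,≥0), (≥0,-)` on `(d, d')` while all are positive on a common
  element `e ∈ A`; Cramer's identity `(d × d')·f(e) = (e × d')·f(d) + (d × e)·f(d')` makes this impossible.)
* `IsLowerSummand`, `TwoSumLowerBound` (CONJECTURE, a `Prop`, not asserted): `#V ≤ #A + #L` whenever `L` contains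
  every strict lower summand of every strict vertex.  Evidence (this seat, exact arithmetic): no violation among
  ~3·10⁴ random and ~10⁶ adversarially annealed instances; equality is attained (e.g. the eleven-point instance
  `cxD3` of `SoloBlindTwoSumRefutation`: 13 = 10 + 3).  `twoSumVertexBoundLin_of_lowerBound`: it implies
  `TwoSumVertexBoundLin` with `c = 2`, hence `CoreVertexBoundLin` and the linear Newton-polygon bound for
  `f·g + 1` recorded in `SoloBlindNewtonRungs` / `SoloBlindCoreRefutation`.
-/

namespace Summit.ValiantsHypothesis.ValiantsHypothesis.Theorems

/-- `lin` on a difference. -/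
theorem lin_sub (a b : ℤ) (x y : ℤ × ℤ) : lin a b (x - y) = lin a b x - lin a b y := by
  simp only [lin, Prod.fst_sub, Prod.snd_sub]; ring

/-- A witnessing functional of a strict vertex is weakly minimised at the vertex over all outer sums. -/
theorem le_of_witness {I : Finset (ℤ × ℤ)} {v w : ℤ × ℤ} {a b : ℤ}
    (hmin : ∀ w ∈ outerSums I, w ≠ v → lin a b v < lin a b w) (hw : w ∈ outerSums I) :
    lin a b v ≤ lin a b w := by
  by_cases h : w = v
  · rw [h]
  · exact le_of_lt (hmin w hw h)

/-! ### Minimality lemmas -/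

/-- **Workhorse.**  If `(a,b)` is uniquely minimised over `W(I)` at `v`, then every pair sum `r + s` of nonzero
elements of `I` with `lin a b (r + s) < lin a b v` lies in `I`. -/
theorem pairSum_mem_of_lt {I : Finset (ℤ × ℤ)} {v r s : ℤ × ℤ} {a b : ℤ}
    (hmin : ∀ w ∈ outerSums I, w ≠ v → lin a b v < lin a b w)
    (hr : r ∈ I.erase 0) (hs : s ∈ I.erase 0) (hlt : lin a b (r + s) < lin a b v) : r + s ∈ I := by
  by_contra hnot
  have hW : r + s ∈ outerSums I := mem_outerSums.mpr ⟨⟨r, hr, s, hs, rfl⟩, hnot⟩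
  have hne : r + s ≠ v := by
    intro h; rw [h] at hlt; exact lt_irrefl _ hlt
  exact absurd (hmin _ hW hne) (not_lt.mpr (le_of_lt hlt))

/-- **Partner lemma (M).**  If `(a,b)` is uniquely minimised over `W(I)` at `p + q` (`p ∈ A`), then every `r ∈ A`
strictly below `q` is a partner of `p`: `p + r ∈ I`. -/
theorem partner_of_lt_upper {I : Finset (ℤ × ℤ)} {p q r : ℤ × ℤ} {a b : ℤ}
    (hmin : ∀ w ∈ outerSums I, w ≠ p + q → lin a b (p + q) < lin a b w)
    (hp : p ∈ I.erase 0) (hr : r ∈ I.erase 0) (hlt : lin a b r < lin a b q) : p + r ∈ I :=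
  pairSum_mem_of_lt hmin hp hr (by simp only [lin_add]; linarith)

/-- **Doubling lemma.**  A strict lower summand is doubled inside `I`: if `(a,b)` is uniquely minimised over `W(I)`
at `p + q` and `lin a b p < lin a b q`, then `p + p ∈ I`. -/
theorem lower_double_mem {I : Finset (ℤ × ℤ)} {p q : ℤ × ℤ} {a b : ℤ}
    (hmin : ∀ w ∈ outerSums I, w ≠ p + q → lin a b (p + q) < lin a b w)
    (hp : p ∈ I.erase 0) (hlt : lin a b p < lin a b q) : p + p ∈ I :=
  partner_of_lt_upper hmin hp hp hlt

/-- **Key lemma.**  If `(a,b)` is uniquely minimised over `W(I)` at `p + q`, then an element `r ∈ A` strictly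
below `p` is partnered with every `s ∈ A` weakly below `q`: `r + s ∈ I`. -/
theorem pairSum_mem_of_below_lower {I : Finset (ℤ × ℤ)} {p q r s : ℤ × ℤ} {a b : ℤ}
    (hmin : ∀ w ∈ outerSums I, w ≠ p + q → lin a b (p + q) < lin a b w)
    (hr : r ∈ I.erase 0) (hs : s ∈ I.erase 0)
    (hrp : lin a b r < lin a b p) (hsq : lin a b s ≤ lin a b q) : r + s ∈ I :=
  pairSum_mem_of_lt hmin hr hs (by simp only [lin_add]; linarith)

/-- `p` is a **strict lower summand** of the strict vertex `v`: `v ∈ W(I)`, `p, v - p ∈ A`, and some functional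
positive on `A` and uniquely minimised over `W(I)` at `v` is strictly smaller at `p` than at `v - p`. -/
def IsLowerSummand (I : Finset (ℤ × ℤ)) (v p : ℤ × ℤ) : Prop :=
  v ∈ outerSums I ∧ p ∈ I.erase 0 ∧ v - p ∈ I.erase 0 ∧ ∃ a b : ℤ, (∀ e ∈ I.erase 0, 0 < lin a b e) ∧
    (∀ w ∈ outerSums I, w ≠ v → lin a b v < lin a b w) ∧ lin a b p < lin a b (v - p)

/-- A vertex with a strict lower summand is a strict vertex. -/
theorem IsLowerSummand.isStrictVertex {I : Finset (ℤ × ℤ)} {v p : ℤ × ℤ} (h : IsLowerSummand I v p) :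
    IsStrictVertex I v := by
  obtain ⟨hv, _, _, a, b, hpos, hmin, _⟩ := h
  exact ⟨hv, a, b, hpos, hmin⟩

/-- A strict lower summand is doubled inside `I` (restatement of `lower_double_mem`). -/
theorem IsLowerSummand.double_mem {I : Finset (ℤ × ℤ)} {v p : ℤ × ℤ} (h : IsLowerSummand I v p) :
    p + p ∈ I := by
  obtain ⟨_, hp, _, a, b, _, hmin, hlt⟩ := h
  have hv : p + (v - p) = v := by abel
  rw [← hv] at hmin
  exact lower_double_mem hmin hp hlt

/-- **Loops exclude lower summands.**  If `p + p` is a strict vertex then `p` is not a strict lower summand of any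
strict vertex (its double would have to lie in `I`, but it is an outer sum). -/
theorem not_lowerSummand_of_double_vertex {I : Finset (ℤ × ℤ)} {v p : ℤ × ℤ}
    (hpp : IsStrictVertex I (p + p)) : ¬ IsLowerSummand I v p :=
  fun h => (mem_outerSums.mp hpp.1).2 h.double_mem

/-! ### Rectangle-freeness -/

/-- The planar cross product. -/
def cross (u v : ℤ × ℤ) : ℤ := u.1 * v.2 - u.2 * v.1

/-- Cramer's identity for `lin`: `(d × d')·f(e) = (e × d')·f(d) + (d × e)·f(d')`. -/
theorem cross_lin_identity (a b : ℤ) (d d' e : ℤ × ℤ) :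
    cross d d' * lin a b e = cross e d' * lin a b d + cross d e * lin a b d' := by
  simp only [cross, lin]; ring

/-- If `e` is parallel to `d` then `f(d)·(e·e) = f(e)·(d·e)` for every functional `f`. -/
theorem lin_parallel (a b : ℤ) (d e : ℤ × ℤ) (h : cross d e = 0) :
    lin a b d * (e.1 * e.1 + e.2 * e.2) = lin a b e * (d.1 * e.1 + d.2 * e.2) := by
  have h' : d.1 * e.2 = d.2 * e.1 := by unfold cross at h; linarith
  simp only [lin]
  linear_combination (a * e.2 - b * e.1) * h'

/-- Sign core of rectangle-freeness, parallel case: two functionals positive at `e` cannot have opposite strict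
signs at a vector `d` parallel to `e`. -/
theorem parallel_sign_absurd {a₁ b₁ a₃ b₃ : ℤ} {d e : ℤ × ℤ} (hpar : cross d e = 0)
    (hE₁ : 0 < lin a₁ b₁ e) (hE₃ : 0 < lin a₃ b₃ e) (hs₁ : 0 < lin a₁ b₁ d) (hs₃ : lin a₃ b₃ d < 0) :
    False := by
  have hee : 0 < e.1 * e.1 + e.2 * e.2 := by
    rcases e with ⟨x, y⟩
    have hxy : x ≠ 0 ∨ y ≠ 0 := by
      by_contra h
      simp only [not_or, ne_eq, not_not] at h
      obtain ⟨rfl, rfl⟩ := h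
      simp [lin] at hE₁
    rcases hxy with hx | hy
    · have := mul_self_pos.mpr hx; nlinarith [mul_self_nonneg y]
    · have := mul_self_pos.mpr hy; nlinarith [mul_self_nonneg x]
  have i₁ := lin_parallel a₁ b₁ d e hpar
  have i₃ := lin_parallel a₃ b₃ d e hpar
  have hpos : 0 < lin a₁ b₁ e * (d.1 * e.1 + d.2 * e.2) := by rw [← i₁]; positivity
  have hde : 0 < d.1 * e.1 + d.2 * e.2 := pos_of_mul_pos_right hpos (le_of_lt hE₁)
  have hneg : lin a₃ b₃ d * (e.1 * e.1 + e.2 * e.2) < 0 := mul_neg_of_neg_of_pos hs₃ hee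
  rw [i₃] at hneg
  exact absurd (mul_pos hE₃ hde) (not_lt.mpr (le_of_lt hneg))

/-- Sign core of rectangle-freeness, generic case (pure integer arithmetic): with `X, Y ≠ 0` the four relations
`D·Eᵢ = X·sᵢ + Y·tᵢ`, `Eᵢ > 0`, and the sign patterns `(+,+), (≤0,≤0), (-,≥0), (≥0,-)` of `(sᵢ,tᵢ)` are
contradictory. -/
theorem sign_core {D X Y s₁ t₁ s₂ t₂ s₃ t₃ s₄ t₄ E₁ E₂ E₃ E₄ : ℤ} (hX : X ≠ 0) (hY : Y ≠ 0)
    (h₁ : D * E₁ = X * s₁ + Y * t₁) (h₂ : D * E₂ = X * s₂ + Y * t₂)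
    (h₃ : D * E₃ = X * s₃ + Y * t₃) (h₄ : D * E₄ = X * s₄ + Y * t₄)
    (hE₁ : 0 < E₁) (hE₂ : 0 < E₂) (hE₃ : 0 < E₃) (hE₄ : 0 < E₄)
    (hs₁ : 0 < s₁) (ht₁ : 0 < t₁) (hs₂ : s₂ ≤ 0) (ht₂ : t₂ ≤ 0)
    (hs₃ : s₃ < 0) (ht₃ : 0 ≤ t₃) (hs₄ : 0 ≤ s₄) (ht₄ : t₄ < 0) : False := by
  rcases lt_or_gt_of_ne hX with hXn | hXp <;> rcases lt_or_gt_of_ne hY with hYn | hYp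
  · -- X < 0, Y < 0 : relation 1 forces D < 0, relation 2 forces D ≥ 0
    have p₁ : X * s₁ < 0 := mul_neg_of_neg_of_pos hXn hs₁
    have q₁ : Y * t₁ < 0 := mul_neg_of_neg_of_pos hYn ht₁
    have p₂ : 0 ≤ X * s₂ := by nlinarith
    have q₂ : 0 ≤ Y * t₂ := by nlinarith
    have hD : D < 0 := by nlinarith
    nlinarith
  · -- X < 0, Y > 0 : relation 3 forces D > 0, relation 4 forces D < 0
    have p₃ : 0 < X * s₃ := mul_pos_of_neg_of_neg hXn hs₃
    have q₃ : 0 ≤ Y * t₃ := mul_nonneg (le_of_lt hYp) ht₃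
    have p₄ : X * s₄ ≤ 0 := by nlinarith
    have q₄ : Y * t₄ < 0 := mul_neg_of_pos_of_neg hYp ht₄
    have hD : 0 < D := by nlinarith
    nlinarith
  · -- X > 0, Y < 0 : relation 3 forces D < 0, relation 4 forces D > 0
    have p₃ : X * s₃ < 0 := mul_neg_of_pos_of_neg hXp hs₃
    have q₃ : Y * t₃ ≤ 0 := by nlinarith
    have p₄ : 0 ≤ X * s₄ := mul_nonneg (le_of_lt hXp) hs₄
    have q₄ : 0 < Y * t₄ := mul_pos_of_neg_of_neg hYn ht₄
    have hD : D < 0 := by nlinarith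
    nlinarith
  · -- X > 0, Y > 0 : relation 1 forces D > 0, relation 2 forces D ≤ 0
    have p₁ : 0 < X * s₁ := mul_pos hXp hs₁
    have q₁ : 0 < Y * t₁ := mul_pos hYp ht₁
    have p₂ : X * s₂ ≤ 0 := by nlinarith
    have q₂ : Y * t₂ ≤ 0 := by nlinarith
    have hD : 0 < D := by nlinarith
    nlinarith

/-- **Rectangle-freeness of the strict vertices.**  If `v₁, v₂, v₃, v₄` are strict vertices with
`v₁ + v₂ = v₃ + v₄`, then `{v₁, v₂} = {v₃, v₄}`.  In particular the vertex graph contains no 4-cycle of strict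
vertices (`p+q, p'+q, p'+q', p+q'` would give `(p+q) + (p'+q') = (p'+q) + (p+q')`), and no strict vertex is the
midpoint of two others. -/
theorem strictVertex_no_parallelogram {I : Finset (ℤ × ℤ)} {v₁ v₂ v₃ v₄ : ℤ × ℤ}
    (h₁ : IsStrictVertex I v₁) (h₂ : IsStrictVertex I v₂) (h₃ : IsStrictVertex I v₃)
    (h₄ : IsStrictVertex I v₄) (hsum : v₁ + v₂ = v₃ + v₄) :
    (v₁ = v₃ ∧ v₂ = v₄) ∨ (v₁ = v₄ ∧ v₂ = v₃) := by
  by_cases e13 : v₁ = v₃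
  · left
    refine ⟨e13, ?_⟩
    rw [e13] at hsum
    exact add_left_cancel hsum
  by_cases e14 : v₁ = v₄
  · right
    refine ⟨e14, ?_⟩
    rw [e14, add_comm v₃ v₄] at hsum
    exact add_left_cancel hsum
  exfalso
  obtain ⟨hW₁, a₁, b₁, hpos₁, hmin₁⟩ := h₁
  obtain ⟨hW₂, a₂, b₂, hpos₂, hmin₂⟩ := h₂
  obtain ⟨hW₃, a₃, b₃, hpos₃, hmin₃⟩ := h₃
  obtain ⟨hW₄, a₄, b₄, hpos₄, hmin₄⟩ := h₄
  -- a common element `e ∈ A` (a summand of `v₁`)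
  obtain ⟨⟨e, he, -, -, -⟩, -⟩ := mem_outerSums.mp hW₁
  have hE₁ := hpos₁ e he
  have hE₂ := hpos₂ e he
  have hE₃ := hpos₃ e he
  have hE₄ := hpos₄ e he
  -- the eight comparisons between the vertices
  have F13 : lin a₁ b₁ v₁ < lin a₁ b₁ v₃ := hmin₁ v₃ hW₃ (fun h => e13 h.symm)
  have F14 : lin a₁ b₁ v₁ < lin a₁ b₁ v₄ := hmin₁ v₄ hW₄ (fun h => e14 h.symm)
  have F31 : lin a₃ b₃ v₃ < lin a₃ b₃ v₁ := hmin₃ v₁ hW₁ e13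
  have F32 : lin a₃ b₃ v₃ ≤ lin a₃ b₃ v₂ := le_of_witness hmin₃ hW₂
  have F41 : lin a₄ b₄ v₄ < lin a₄ b₄ v₁ := hmin₄ v₁ hW₁ e14
  have F42 : lin a₄ b₄ v₄ ≤ lin a₄ b₄ v₂ := le_of_witness hmin₄ hW₂
  have F23 : lin a₂ b₂ v₂ ≤ lin a₂ b₂ v₃ := le_of_witness hmin₂ hW₃
  have F24 : lin a₂ b₂ v₂ ≤ lin a₂ b₂ v₄ := le_of_witness hmin₂ hW₄
  -- the relation, pushed through each functional
  have H : ∀ a b : ℤ, lin a b v₁ + lin a b v₂ = lin a b v₃ + lin a b v₄ := by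
    intro a b
    have := congrArg (lin a b) hsum
    simpa only [lin_add] using this
  have H₂ := H a₂ b₂
  have H₃ := H a₃ b₃
  have H₄ := H a₄ b₄
  -- the two difference vectors
  set d := v₃ - v₁ with hd
  set d' := v₄ - v₁ with hd'
  have Ld : ∀ a b : ℤ, lin a b d = lin a b v₃ - lin a b v₁ := fun a b => by rw [hd, lin_sub]
  have Ld' : ∀ a b : ℤ, lin a b d' = lin a b v₄ - lin a b v₁ := fun a b => by rw [hd', lin_sub]
  have hs₁ : 0 < lin a₁ b₁ d := by rw [Ld]; linarith
  have ht₁ : 0 < lin a₁ b₁ d' := by rw [Ld']; linarith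
  have hs₂ : lin a₂ b₂ d ≤ 0 := by rw [Ld]; linarith
  have ht₂ : lin a₂ b₂ d' ≤ 0 := by rw [Ld']; linarith
  have hs₃ : lin a₃ b₃ d < 0 := by rw [Ld]; linarith
  have ht₃ : 0 ≤ lin a₃ b₃ d' := by rw [Ld']; linarith
  have hs₄ : 0 ≤ lin a₄ b₄ d := by rw [Ld]; linarith
  have ht₄ : lin a₄ b₄ d' < 0 := by rw [Ld']; linarith
  -- `e` is parallel to neither `d` nor `d'`
  have hY : cross d e ≠ 0 := fun h0 => parallel_sign_absurd h0 hE₁ hE₃ hs₁ hs₃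
  have hX : cross e d' ≠ 0 := by
    intro h0
    have h0' : cross d' e = 0 := by unfold cross at h0 ⊢; linarith
    exact parallel_sign_absurd h0' hE₁ hE₄ ht₁ ht₄
  exact sign_core hX hY (cross_lin_identity a₁ b₁ d d' e) (cross_lin_identity a₂ b₂ d d' e)
    (cross_lin_identity a₃ b₃ d d' e) (cross_lin_identity a₄ b₄ d d' e) hE₁ hE₂ hE₃ hE₄
    hs₁ ht₁ hs₂ ht₂ hs₃ ht₃ hs₄ ht₄

/-- Corollary: no strict vertex is the midpoint of two other strict vertices. -/
theorem strictVertex_not_midpoint {I : Finset (ℤ × ℤ)} {v u w : ℤ × ℤ}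
    (hv : IsStrictVertex I v) (hu : IsStrictVertex I u) (hw : IsStrictVertex I w) (h : u + w = v + v) :
    u = v ∧ w = v := by
  rcases strictVertex_no_parallelogram hu hw hv hv h with ⟨h1, h2⟩ | ⟨h1, h2⟩
  · exact ⟨h1, h2⟩
  · exact ⟨h1, h2⟩

/-- Corollary: the vertex graph has no 4-cycle of strict vertices — if `p+q, p'+q, p'+q', p+q'` are all strict
vertices then `p = p'` or `q = q'`. -/
theorem strictVertex_no_fourCycle {I : Finset (ℤ × ℤ)} {p p' q q' : ℤ × ℤ}
    (h₁ : IsStrictVertex I (p + q)) (h₂ : IsStrictVertex I (p' + q')) (h₃ : IsStrictVertex I (p' + q))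
    (h₄ : IsStrictVertex I (p + q')) : p = p' ∨ q = q' := by
  have hsum : (p + q) + (p' + q') = (p' + q) + (p + q') := by abel
  rcases strictVertex_no_parallelogram h₁ h₂ h₃ h₄ hsum with ⟨h, -⟩ | ⟨h, -⟩
  · left; exact add_right_cancel h
  · right; exact add_left_cancel h

/-! ### The lower-summand conjecture -/

/-- **Lower-summand bound** (CONJECTURE; a `Prop`, not asserted).  For every finite `I ⊆ ℤ²`: if `V` consists of
strict vertices of `conv W(I) + cone A` and `L` contains every strict lower summand of every strict vertex, then
`#V ≤ #A + #L` (`A = I ∖ {0}`).  No validity hypothesis.  Evidence (this seat, exact arithmetic over ~3·10⁴ random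
and ~10⁶ adversarially annealed instances with `#A ≤ 22`): no violation; equality attained (e.g. `cxD3`:
`13 = 10 + 3`).  Since a lower summand is doubled inside `I` (`IsLowerSummand.double_mem`) this sharpens — and via
`twoSumVertexBoundLin_of_lowerBound` implies — `TwoSumVertexBoundLin` with constant `2`. -/
@[conjecture] def TwoSumLowerBound : Prop :=
  ∀ I V L : Finset (ℤ × ℤ), (∀ v ∈ V, IsStrictVertex I v) →
    (∀ v p : ℤ × ℤ, IsLowerSummand I v p → p ∈ L) → V.card ≤ (I.erase 0).card + L.card

/-- The lower-summand bound implies the linear two-sum vertex bound with `c = 2` (validity is not even needed). -/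
theorem twoSumVertexBoundLin_of_lowerBound (h : TwoSumLowerBound) : TwoSumVertexBoundLin := by
  classical
  refine ⟨2, fun I V _ _ hV => ?_⟩
  let L : Finset (ℤ × ℤ) := (I.erase 0).filter (fun p => ∃ v, IsLowerSummand I v p)
  have hL : ∀ v p : ℤ × ℤ, IsLowerSummand I v p → p ∈ L := by
    intro v p hp
    exact Finset.mem_filter.mpr ⟨hp.2.1, v, hp⟩
  have h1 := h I V L hV hL
  have h2 : L.card ≤ (I.erase 0).card := Finset.card_le_card (Finset.filter_subset _ _)
  have h3 : (I.erase 0).card ≤ I.card := Finset.card_le_card (Finset.erase_subset _ _)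
  omega


end Summit.ValiantsHypothesis.ValiantsHypothesis.Theorems
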